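import Mathlib

/-!
# Imbrie (2016), Assumption LLA — the interacting two-spin block: trace invariants and the pairing identity

CITATION HEADER (lean-in-tree rule 2026-08-18). J. Z. Imbrie, *On many-body localization for quantum spin chains*,
J. Stat. Phys. **163** (2016) 998–1048, doi 10.1007/s10955-016-1508-x, arXiv:1403.7837 [ImbrieJSP2016], eq. (1.1) (the chain
`H = Σ h_i S^z_i + Σ γ_i S^x_i + Σ J_i S^z_i S^z_{i+1}`), eq. (1.3) (Assumption LLA(ν, C)) and §4.2.1.

WHAT IS PROVED (lemmas of the audit cell `pub-imbrie`, seat LLA gen 6, file `LLA.md` gen-6 block N / `work/int2/INT2-NOTES.md`;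
NOT statements of the paper).  The smallest INTERACTING block of the chain (1.1) is the two-spin Hamiltonian
`H = h₁Z₁ + h₂Z₂ + J Z₁Z₂ + t₁X₁ + t₂X₂`, i.e. in the basis (↑↑, ↑↓, ↓↑, ↓↓) the real symmetric matrix
`M = !![h₁+h₂+J, t₂, t₁, 0; t₂, h₁-h₂-J, 0, t₁; t₁, 0, -h₁+h₂-J, t₂; 0, t₁, t₂, -h₁-h₂+J]`.
* `twoSpin_trace`, `twoSpin_trace_sq`, `twoSpin_trace_cube`, `twoSpin_trace_fourth`: `tr M = 0`, `tr M² = 4S`, `tr M³ = 24 h₁h₂J`,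
  `tr M⁴ = 4S² + 16Q` (`S = h₁²+h₂²+J²+t₁²+t₂²`, `Q = h₁²h₂²+h₁²J²+h₂²J²+h₁²t₂²+h₂²t₁²+t₁²t₂²`); with Newton (`e4_of_powerSums_p1_zero`,
  `twoSpin_e4_value`) the four levels have `e₁ = 0, e₂ = −2S, e₃ = 8h₁h₂J, e₄ = S² − 4Q`: characteristic polynomial `E⁴ − 2SE² − 8h₁h₂J·E + S² − 4Q`.
* `twoSpin_pairing_product`: for any reals `E₁,…,E₄, P` with `ΣE_k = 0` and `ΣE_k³ = 24P` (for the levels of `M`: `P = h₁h₂J`,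
  by the spectral theorem `Σλ = tr M`, `Σλ³ = tr M³` — supplied here as hypotheses, not re-proved),
  the three PAIRING functionals satisfy `(E₁+E₄−E₂−E₃)(E₁+E₃−E₂−E₄)(E₁+E₂−E₃−E₄) = 64P`.
* `twoSpin_pairings_le_range`: for ordered levels the two "large" pairings are bounded by the spectral range:
  `|E₁+E₃−E₂−E₄| ≤ E₄−E₁`, `|E₁+E₂−E₃−E₄| ≤ 2(E₄−E₁)`.
* `twoSpin_pairing_lower_bound`: consequently `2R²·|E₁+E₄−E₂−E₃| ≥ 64|P|` whenever `E₄ − E₁ ≤ R` — the deterministic, γ-free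
  inequality `|E₁+E₄−E₂−E₃| ≥ 32|h₁h₂J|/R²` behind the two-sided small-value law `P(|E₁+E₄−E₂−E₃| < η) ≍ η ln²(1/η)` of the cell
  (INT2-NOTES I3): the joint level density of the interacting two-spin block is unbounded (log-concentrated on symmetric spectra),
  while single gaps `E_k − E_l` (the LLA events) are transversal to that surface.
STATUS: polynomial identities and elementary inequalities over `ℝ`; says NOTHING about whether LLA holds for the chain (OPEN, pub-imbrie LLA.md).
No `sorry`, no new axioms, no definitions.
-/

namespace Literature.MathematicalPhysics.QuantumLattice.Imbrie2016

/-- `tr M = 0` for the two-spin block matrix. [cite: ImbrieJSP2016, eq. (1.1)] -/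
theorem twoSpin_trace (h₁ h₂ J t₁ t₂ : ℝ) :
    Matrix.trace !![h₁+h₂+J, t₂, t₁, 0; t₂, h₁-h₂-J, 0, t₁; t₁, 0, -h₁+h₂-J, t₂; 0, t₁, t₂, -h₁-h₂+J] = 0 := by
  simp [Matrix.trace, Fin.sum_univ_four]
  ring

/-- `tr M² = 4(h₁²+h₂²+J²+t₁²+t₂²)`. [cite: ImbrieJSP2016, eq. (1.1)] -/
theorem twoSpin_trace_sq (h₁ h₂ J t₁ t₂ : ℝ) :
    Matrix.trace (!![h₁+h₂+J, t₂, t₁, 0; t₂, h₁-h₂-J, 0, t₁; t₁, 0, -h₁+h₂-J, t₂; 0, t₁, t₂, -h₁-h₂+J] *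
      !![h₁+h₂+J, t₂, t₁, 0; t₂, h₁-h₂-J, 0, t₁; t₁, 0, -h₁+h₂-J, t₂; 0, t₁, t₂, -h₁-h₂+J])
      = 4 * (h₁^2 + h₂^2 + J^2 + t₁^2 + t₂^2) := by
  simp [Matrix.trace, Fin.sum_univ_four]
  ring

/-- `tr M³ = 24 h₁ h₂ J` (hence `e₃ = 8 h₁h₂J` for the four levels). [cite: ImbrieJSP2016, eq. (1.1)] -/
theorem twoSpin_trace_cube (h₁ h₂ J t₁ t₂ : ℝ) :
    Matrix.trace (!![h₁+h₂+J, t₂, t₁, 0; t₂, h₁-h₂-J, 0, t₁; t₁, 0, -h₁+h₂-J, t₂; 0, t₁, t₂, -h₁-h₂+J] *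
      !![h₁+h₂+J, t₂, t₁, 0; t₂, h₁-h₂-J, 0, t₁; t₁, 0, -h₁+h₂-J, t₂; 0, t₁, t₂, -h₁-h₂+J] *
      !![h₁+h₂+J, t₂, t₁, 0; t₂, h₁-h₂-J, 0, t₁; t₁, 0, -h₁+h₂-J, t₂; 0, t₁, t₂, -h₁-h₂+J])
      = 24 * h₁ * h₂ * J := by
  simp [Matrix.trace, Fin.sum_univ_four]
  ring

/-- `tr M⁴ = 4S² + 16Q` with `S = h₁²+h₂²+J²+t₁²+t₂²`, `Q = h₁²h₂² + h₁²J² + h₂²J² + h₁²t₂² + h₂²t₁² + t₁²t₂²`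
(so, by Newton with `e₁ = 0`, `e₄ = det M = S² − 4Q` and the characteristic polynomial of the block is
`E⁴ − 2S E² − 8(h₁h₂J) E + S² − 4Q`). [cite: ImbrieJSP2016, eq. (1.1)] -/
theorem twoSpin_trace_fourth (h₁ h₂ J t₁ t₂ : ℝ) :
    Matrix.trace (!![h₁+h₂+J, t₂, t₁, 0; t₂, h₁-h₂-J, 0, t₁; t₁, 0, -h₁+h₂-J, t₂; 0, t₁, t₂, -h₁-h₂+J] *
      !![h₁+h₂+J, t₂, t₁, 0; t₂, h₁-h₂-J, 0, t₁; t₁, 0, -h₁+h₂-J, t₂; 0, t₁, t₂, -h₁-h₂+J] *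
      !![h₁+h₂+J, t₂, t₁, 0; t₂, h₁-h₂-J, 0, t₁; t₁, 0, -h₁+h₂-J, t₂; 0, t₁, t₂, -h₁-h₂+J] *
      !![h₁+h₂+J, t₂, t₁, 0; t₂, h₁-h₂-J, 0, t₁; t₁, 0, -h₁+h₂-J, t₂; 0, t₁, t₂, -h₁-h₂+J])
      = 4 * (h₁^2 + h₂^2 + J^2 + t₁^2 + t₂^2) ^ 2
        + 16 * (h₁^2*h₂^2 + h₁^2*J^2 + h₂^2*J^2 + h₁^2*t₂^2 + h₂^2*t₁^2 + t₁^2*t₂^2) := by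
  simp [Matrix.trace, Fin.sum_univ_four]
  ring

/-- Newton's identity for four reals with `p₁ = 0`: `e₄ = (p₂² − 2p₄)/8`.  With `twoSpin_trace_sq/fourth` this gives
`E₁E₂E₃E₄ = S² − 4Q` for the levels of the two-spin block. [cite: ImbrieJSP2016, eq. (1.1)] -/
theorem e4_of_powerSums_p1_zero (E₁ E₂ E₃ E₄ : ℝ) (h1 : E₁ + E₂ + E₃ + E₄ = 0) :
    E₁ * E₂ * E₃ * E₄ = ((E₁^2 + E₂^2 + E₃^2 + E₄^2) ^ 2 - 2 * (E₁^4 + E₂^4 + E₃^4 + E₄^4)) / 8 := by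
  have h4 : E₄ = -E₁ - E₂ - E₃ := by linarith
  subst h4
  ring

/-- The spectral determinant in the cell's variables: `((4S)² − 2(4S²+16Q))/8 = S² − 4Q`. [cite: ImbrieJSP2016, eq. (1.1)] -/
theorem twoSpin_e4_value (S Q : ℝ) : ((4 * S) ^ 2 - 2 * (4 * S ^ 2 + 16 * Q)) / 8 = S ^ 2 - 4 * Q := by
  ring

/-- The pairing identity: power sums `p₁ = 0`, `p₃ = 24P` force the product of the three pairings to be `64P`
(Newton: `e₃ = p₃/3 = 8P`; with `E₄ = −E₁−E₂−E₃` the pairings are `−2(E₂+E₃), 2(E₁+E₃), 2(E₁+E₂)` and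
`p₃ = −3(E₁+E₂)(E₁+E₃)(E₂+E₃)`). [cite: ImbrieJSP2016, eq. (1.1), (1.3)] -/
theorem twoSpin_pairing_product (E₁ E₂ E₃ E₄ P : ℝ) (h1 : E₁ + E₂ + E₃ + E₄ = 0)
    (h3 : E₁ ^ 3 + E₂ ^ 3 + E₃ ^ 3 + E₄ ^ 3 = 24 * P) :
    (E₁ + E₄ - E₂ - E₃) * (E₁ + E₃ - E₂ - E₄) * (E₁ + E₂ - E₃ - E₄) = 64 * P := by
  have h4 : E₄ = -E₁ - E₂ - E₃ := by linarith
  subst h4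
  linear_combination (8 / 3 : ℝ) * h3

/-- For ordered levels the two "large" pairings are bounded by the spectral range. [cite: ImbrieJSP2016, eq. (1.3)] -/
theorem twoSpin_pairings_le_range (E₁ E₂ E₃ E₄ : ℝ) (h12 : E₁ ≤ E₂) (h23 : E₂ ≤ E₃) (h34 : E₃ ≤ E₄) :
    |E₁ + E₃ - E₂ - E₄| ≤ E₄ - E₁ ∧ |E₁ + E₂ - E₃ - E₄| ≤ 2 * (E₄ - E₁) := by
  constructor
  · rw [abs_le]; constructor <;> linarith
  · rw [abs_le]; constructor <;> linarith

/-- The deterministic, γ-free lower bound on the "small" pairing of the two-spin block: if the four ordered levels have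
`ΣE = 0`, `ΣE³ = 24P` (`P = h₁h₂J`) and range `E₄ − E₁ ≤ R`, then `2R² · |E₁+E₄−E₂−E₃| ≥ 64|P|`.
[cite: ImbrieJSP2016, eq. (1.1), (1.3)] -/
theorem twoSpin_pairing_lower_bound (E₁ E₂ E₃ E₄ P R : ℝ) (h12 : E₁ ≤ E₂) (h23 : E₂ ≤ E₃) (h34 : E₃ ≤ E₄)
    (h1 : E₁ + E₂ + E₃ + E₄ = 0) (h3 : E₁ ^ 3 + E₂ ^ 3 + E₃ ^ 3 + E₄ ^ 3 = 24 * P) (hR : E₄ - E₁ ≤ R) :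
    64 * |P| ≤ 2 * R ^ 2 * |E₁ + E₄ - E₂ - E₃| := by
  have hprod := twoSpin_pairing_product E₁ E₂ E₃ E₄ P h1 h3
  obtain ⟨hG₂, hG₃⟩ := twoSpin_pairings_le_range E₁ E₂ E₃ E₄ h12 h23 h34
  have hRange : 0 ≤ E₄ - E₁ := by linarith
  have hR0 : 0 ≤ R := le_trans hRange hR
  have habs : |E₁ + E₄ - E₂ - E₃| * |E₁ + E₃ - E₂ - E₄| * |E₁ + E₂ - E₃ - E₄| = 64 * |P| := by
    rw [← abs_mul, ← abs_mul, hprod, abs_mul]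
    norm_num
  have hF0 : 0 ≤ |E₁ + E₄ - E₂ - E₃| := abs_nonneg _
  have hG₂' : |E₁ + E₃ - E₂ - E₄| ≤ R := le_trans hG₂ hR
  have hG₃' : |E₁ + E₂ - E₃ - E₄| ≤ 2 * R := le_trans hG₃ (by linarith)
  calc 64 * |P| = |E₁ + E₄ - E₂ - E₃| * |E₁ + E₃ - E₂ - E₄| * |E₁ + E₂ - E₃ - E₄| := habs.symm
    _ ≤ |E₁ + E₄ - E₂ - E₃| * R * (2 * R) := by
        apply mul_le_mul (mul_le_mul_of_nonneg_left hG₂' hF0) hG₃' (abs_nonneg _)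
        exact mul_nonneg hF0 hR0
    _ = 2 * R ^ 2 * |E₁ + E₄ - E₂ - E₃| := by ring

end Literature.MathematicalPhysics.QuantumLattice.Imbrie2016
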